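import Summits.KontsevichZagierPeriods.KontsevichZagierPeriods.Theorems.LinRedNormalFormArrangementNormalFormStubRebaseSimpleZeroNestedDiffFrameA

/-!
# Stub `stub_rebaseSimpleZeroTwo`, part `rebaseSimpleZero_nestedDifferent` (crux
`ArrangementNormalForm`, line `janus-bands`) — brick `NestedDiffCoreA`

**Type A of the rebase of a nested pair with letters of different `y`-slopes: the upper bound of
the outer fibre is parallel to the outer letter.** A clean nest `A(y) < tᵢ < tⱼ < B(y)` over a
one-dimensional base with the literal `GS 0 2` integrand `K/((y − r)(tᵢ − cᵢ(y))(tⱼ − cⱼ(y)))`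
(simple base pole `r`), letters of different slopes `λᵢ ≠ λⱼ` and `B ∥ cⱼ` is good for `GG 0 2 2`
as soon as the edge expansion of `tᵢ` to the slope `λⱼ` about `r` is DOMINATED on the domain,
`|tᵢ − cᵢ(y)| ≤ C |tᵢ − rot(cᵢ, λⱼ, r)(y)|` (e.g. `tᵢ − cᵢ` and `(λⱼ − λᵢ)(y − r)` of opposite
signs, `RebaseDiff.good_typeA_of_signs`), the letter of `tᵢ` and the base pole not vanishing on
the domain:
* `RebaseDiff.good_coreA` — normalised form (outer letter and `B` constant, inner letter of slope
  `λ ≠ 0`, target slope `0`): edge expansion (`RebaseDiff.expand`, rule 1b); the letter piece has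
  constant letters (`RebaseDiff.good_any`); the frame piece is `RebaseDiff.good_frameA`;
* `RebaseDiff.good_typeA` — general slopes: joint shear of both fibres along `λⱼ` (rule 2,
  `RebaseNest.nest_shear`), then `good_coreA`; registered as `rebaseSimpleZero_nestedDiffA`.

References: M. Kontsevich, D. Zagier, *Periods* (2001), §1.2, rules (1a), (1b), (2).
-/

noncomputable section

open Set MeasureTheory MvPolynomial
open Literature.NumberTheory.Transcendental Literature.ModelTheory.ExponentialFields

namespace Summit.KontsevichZagierPeriods.ArrangementNormalForm.JanusBands

namespace RebaseDiff

open SeparatePos RebasePos RebaseZero RebaseNest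

variable {m m' : ℕ} {i j : Fin 2}

/-- **Type A, normalised form.** A clean nest `A(y) < tᵢ < tⱼ < β` (`β` constant) with the
literal integrand `K/((y − r)(tᵢ − cᵢ(y))(tⱼ − κ))` — simple base pole `r = ℓ₂`, inner letter
`cᵢ` of slope `λ ≠ 0`, outer letter `κ` constant — such that `y ≠ r` and `tᵢ ≠ cᵢ(y)` on the
domain and the edge expansion of `tᵢ` to the slope `0` about `r` is dominated there
(`|tᵢ − cᵢ(y)| ≤ C |tᵢ − ρ|`, `ρ = cᵢ(r)`) is good for `GG 0 2 2`.
[Kontsevich–Zagier 2001, §1.2, rules (1a), (1b), (2)] -/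
theorem good_coreA (s : KZ.IntegralRep (0 + 1 + 2)) (hij : i ≠ j) (M : Fin m' → Cf) (A : Cf) (β : ℚ)
    (T : BData) (p : MvPolynomial (Fin 0) ℚ) (a : Fin 2 → Option Cf) (ci cj : Cf)
    (hi : a i = some ci) (hj : a j = some cj) (hcj : cj.1 (Fin.last 0) = 0) (h1 : T.n₁ = 0)
    (hn : T.n₂ = 1) (hlam : ci.1 (Fin.last 0) ≠ 0) (hbd : Bornology.IsBounded s.domain)
    (hdom : s.domain = gDom 0 2 m' M (nlo i A) (nhi j (mk 0 β)))
    (hint : EqOn s.integrand (glitB T p a) s.domain)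
    (hne : ∀ z ∈ s.domain, tv z i ≠ ev ci (yv z)) (hy : ∀ z ∈ s.domain, yv z ≠ T.ℓ₂.2) (C : ℝ)
    (hC : ∀ z ∈ s.domain, |tv z i - ev ci (yv z)| ≤ C * |tv z i - ev (rot ci 0 T.ℓ₂.2) (yv z)|) :
    Good 2 (KZ.of s) := by
  obtain ⟨s₁, s₂, hd₁, hd₂, hbd₁, hdom₁, hint₁, hint₂, hrel⟩ :=
    expand s M (nlo i A) (nhi j (mk 0 β)) T p a hbd hdom hint i ci hi 0 T.ℓ₂.2 hne C hC
  have hR : ∀ z ∈ s.domain, tv z i ≠ ev (rot ci 0 T.ℓ₂.2) (yv z) := fun z hz h => by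
    have := hC z hz
    rw [sub_eq_zero.2 h, abs_zero, mul_zero] at this
    exact hne z hz (sub_eq_zero.1 (abs_eq_zero.1 (le_antisymm this (abs_nonneg _))))
  refine good_of_rel3 hrel ?_ ?_
  · -- the letter piece: constant letters
    refine good_any s₁ M T.L T.e p T.ℓ₁ T.ℓ₂ (Function.update a i (some (rot ci 0 T.ℓ₂.2))) (nlo i A)
      (nhi j (mk 0 β)) h1 hn ⟨0, fun l c hc => ?_⟩ hbd₁ hdom₁ hint₁
    rcases fin_two_eq_or hij l with rfl | rfl
    · rw [Function.update_self] at hc; cases hc; rfl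
    · rw [Function.update_of_ne hij.symm, hj] at hc; cases hc; exact hcj
  · -- the frame piece
    have hs₂ : s₂.domain = s.domain := hd₂
    exact good_frameA s₂ hij M A β T p a ci cj hi hj hcj h1 hn hlam (hs₂ ▸ hbd) (hs₂.trans hdom)
      (fun z hz => by rw [hint₂ z, hint (hs₂ ▸ hz)]) (fun z hz => hne z (hs₂ ▸ hz))
      (fun z hz => hR z (hs₂ ▸ hz)) (fun z hz => hy z (hs₂ ▸ hz))

/-- The rotated letter after the joint shear along the target slope is the rotated sheared letter
(to the slope `0`), as far as values are concerned. -/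
theorem ev_pullC_rot (ci : Cf) (lam r : ℚ) (y : ℝ) :
    ev (pullC 1 lam 0 (rot ci lam r)) y = ev (rot (pullC 1 lam 0 ci) 0 r) y := by
  simp only [pullC_mk, rot, ev_mk, mk_fst, mk_snd, Prod.snd_zero, sub_zero, div_one]
  push_cast
  ring

/-- **Type A: the upper bound of the outer fibre is parallel to the outer letter.** A clean nest
`A(y) < tᵢ < tⱼ < B(y)` with the literal `GS 0 2` integrand (simple base pole `r = ℓ₂`, letters
`cᵢ, cⱼ` of different `y`-slopes `λᵢ ≠ λⱼ`) and `B ∥ cⱼ` such that `y ≠ r` and `tᵢ ≠ cᵢ(y)` on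
the domain and the edge expansion of `tᵢ` to the slope `λⱼ` about `r` is dominated there,
`|tᵢ − cᵢ(y)| ≤ C |tᵢ − rot(cᵢ, λⱼ, r)(y)|`, is good for `GG 0 2 2`: joint shear of both fibres
along `λⱼ` (rule 2), then the normalised form `good_coreA`. [Kontsevich–Zagier 2001, §1.2,
rules (1a), (1b), (2)] -/
theorem good_typeA (s : KZ.IntegralRep (0 + 1 + 2)) (hij : i ≠ j) (M : Fin m' → Cf) (A Bd : Cf)
    (L : Fin m → (Fin 0 → ℚ) × ℚ) (e : Fin m → ℕ) (p : MvPolynomial (Fin 0) ℚ) (ℓ₁ ℓ₂ : (Fin 0 → ℚ) × ℚ)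
    (n₁ n₂ : ℕ) (a : Fin 2 → Option Cf) (ci cj : Cf) (hi : a i = some ci) (hj : a j = some cj)
    (hB : Bd.1 (Fin.last 0) = cj.1 (Fin.last 0)) (hΔ : ci.1 (Fin.last 0) ≠ cj.1 (Fin.last 0))
    (h1 : n₁ = 0) (hn : n₂ = 1) (hbd : Bornology.IsBounded s.domain)
    (hdom : s.domain = gDom 0 2 m' M (nlo i A) (nhi j Bd))
    (hint : EqOn s.integrand (glit 0 2 p L e ℓ₁ ℓ₂ n₁ n₂ a) s.domain)
    (hne : ∀ z ∈ s.domain, tv z i ≠ ev ci (yv z)) (hy : ∀ z ∈ s.domain, yv z ≠ ℓ₂.2) (C : ℝ)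
    (hC : ∀ z ∈ s.domain, |tv z i - ev ci (yv z)| ≤ C * |tv z i - ev (rot ci (cj.1 (Fin.last 0)) ℓ₂.2) (yv z)|) :
    Good 2 (KZ.of s) := by
  set lam : ℚ := cj.1 (Fin.last 0) with hlamdef
  -- joint shear along `λⱼ`
  obtain ⟨s', hkey, hbd', hdom', hint', hrel⟩ := pull (fun _ : Fin 2 => (1 : ℚ)) (fun _ => lam) (fun _ => 0)
    s M L e p ℓ₁ ℓ₂ n₁ n₂ a (nlo i A) (nhi j Bd) hbd hdom hint (fun _ => one_ne_zero) (hlink_const 1 lam _ _)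
  rw [pullLo_shear, pullHi_shear] at hdom'
  have hai' : pullA (fun _ : Fin 2 => (1 : ℚ)) (fun _ => lam) (fun _ => 0) a i = some (pullC 1 lam 0 ci) := by
    simp only [pullA, hi, Option.map_some]
  have haj' : pullA (fun _ : Fin 2 => (1 : ℚ)) (fun _ => lam) (fun _ => 0) a j = some (pullC 1 lam 0 cj) := by
    simp only [pullA, hj, Option.map_some]
  have hci' : (pullC 1 lam 0 ci).1 (Fin.last 0) = ci.1 (Fin.last 0) - lam := by rw [pullC_fst_last, div_one]
  have hcj' : (pullC 1 lam 0 cj).1 (Fin.last 0) = cj.1 (Fin.last 0) - lam := by rw [pullC_fst_last, div_one]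
  have hBd' : pullC 1 lam 0 Bd = mk 0 Bd.2 := by
    rw [pullC_mk, hB, hlamdef, sub_self, zero_div, Prod.snd_zero, sub_zero, div_one]
  rw [hBd'] at hdom'
  -- transport of the hypotheses through the shear
  have hid : ∀ (c : Cf) (w : Fin (0 + 1 + 2) → ℝ),
      tv (pullInv (fun _ : Fin 2 => (1 : ℚ)) (fun _ => lam) (fun _ => 0) w) i - ev c (yv w) =
        tv w i - ev (pullC 1 lam 0 c) (yv w) := fun c w => by
    have h := pullInv_fib_sub_affF (fun _ : Fin 2 => (1 : ℚ)) (fun _ => lam) (fun _ => 0)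
      (fun _ => one_ne_zero) i c w
    rw [affF_eq, affF_eq, Rat.cast_one, one_mul] at h
    exact h
  have hyv : ∀ w : Fin (0 + 1 + 2) → ℝ,
      yv (pullInv (fun _ : Fin 2 => (1 : ℚ)) (fun _ => lam) (fun _ => 0) w) = yv w := fun w =>
    pullInv_base _ _ _ w (Fin.last 0)
  refine RebaseZero.good_of_sub_mem hrel (good_coreA s' hij M (pullC 1 lam 0 A) Bd.2 ⟨m, L, e, ℓ₁, ℓ₂, n₁, n₂⟩
    (MvPolynomial.C (pullQ (fun _ : Fin 2 => (1 : ℚ)) a) * p) _ (pullC 1 lam 0 ci) (pullC 1 lam 0 cj)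
    hai' haj' (by rw [hcj', hlamdef, sub_self]) h1 hn (by rw [hci']; exact sub_ne_zero.2 hΔ) hbd' hdom' hint'
    (fun w hw => ?_) (fun w hw => ?_) C (fun w hw => ?_))
  · have h := sub_ne_zero.2 (hne _ ((hkey w).1 hw))
    rw [hyv, hid] at h
    exact sub_ne_zero.1 h
  · have h := hy _ ((hkey w).1 hw)
    rwa [hyv] at h
  · have h := hC _ ((hkey w).1 hw)
    rw [hyv, hid, hid, ev_pullC_rot] at h
    exact h

/-- **Type A with automatic domination by signs**: if `tᵢ − cᵢ(y)` has the constant weak sign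
`ε` and `(λⱼ − λᵢ)(y − r)` the weak sign `−ε` on the domain, the edge expansion is dominated with
`C = 1` (`RebaseDiff.dominated_of_signs`). -/
theorem good_typeA_of_signs (s : KZ.IntegralRep (0 + 1 + 2)) (hij : i ≠ j) (M : Fin m' → Cf) (A Bd : Cf)
    (L : Fin m → (Fin 0 → ℚ) × ℚ) (e : Fin m → ℕ) (p : MvPolynomial (Fin 0) ℚ) (ℓ₁ ℓ₂ : (Fin 0 → ℚ) × ℚ)
    (n₁ n₂ : ℕ) (a : Fin 2 → Option Cf) (ci cj : Cf) (hi : a i = some ci) (hj : a j = some cj)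
    (hB : Bd.1 (Fin.last 0) = cj.1 (Fin.last 0)) (hΔ : ci.1 (Fin.last 0) ≠ cj.1 (Fin.last 0))
    (h1 : n₁ = 0) (hn : n₂ = 1) (hbd : Bornology.IsBounded s.domain)
    (hdom : s.domain = gDom 0 2 m' M (nlo i A) (nhi j Bd))
    (hint : EqOn s.integrand (glit 0 2 p L e ℓ₁ ℓ₂ n₁ n₂ a) s.domain)
    (hne : ∀ z ∈ s.domain, tv z i ≠ ev ci (yv z)) (hy : ∀ z ∈ s.domain, yv z ≠ ℓ₂.2) (ε : ℝ)
    (hε : ε = 1 ∨ ε = -1) (hP : ∀ z ∈ s.domain, 0 ≤ ε * (tv z i - ev ci (yv z)))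
    (hQ : ∀ z ∈ s.domain, ε * ((((cj.1 (Fin.last 0) - ci.1 (Fin.last 0) : ℚ) : ℝ)) * (yv z - ℓ₂.2)) ≤ 0) :
    Good 2 (KZ.of s) :=
  good_typeA s hij M A Bd L e p ℓ₁ ℓ₂ n₁ n₂ a ci cj hi hj hB hΔ h1 hn hbd hdom hint hne hy 1 fun z hz =>
    dominated_of_signs i ci (cj.1 (Fin.last 0)) ℓ₂.2 ε hε z (hP z hz) (hQ z hz)

end RebaseDiff

/-- **Registered part `rebaseSimpleZero_nestedDiffA` of `rebaseSimpleZero_nestedDifferent` (stub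
`stub_rebaseSimpleZeroTwo`, line `janus-bands`): type A of the rebase of a nested pair with letters
of DIFFERENT `y`-slopes.** A clean nest `A(y) < tᵢ < tⱼ < B(y)` (literal `GS 0 2` datum, simple
base pole `r = ℓ₂.2`, both fibres lettered, `λᵢ ≠ λⱼ`) whose outer upper bound is parallel to the
outer letter (`B ∥ cⱼ`), on whose domain the base pole and the inner letter do not vanish and the
edge expansion of `tᵢ` to the slope `λⱼ` about `r` is dominated
(`|tᵢ − cᵢ(y)| ≤ C |tᵢ − rot(cᵢ, λⱼ, r)(y)|`; automatic when `tᵢ − cᵢ` and `(λⱼ − λᵢ)(y − r)`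
have opposite signs, `RebaseDiff.good_typeA_of_signs`), is congruent modulo `KZ.relations` to
the subgroup generated by the literal rebased class `GG 0 2 2` (`RebaseDiff.good_typeA`: joint
shear, dominated edge expansion (rule 1b), letter piece by the landed common-slope case, frame
piece by the base chart and the total-order refinement). [Kontsevich–Zagier 2001, §1.2] -/
theorem rebaseSimpleZero_nestedDiffA (m m' n₁ n₂ : ℕ) (s : KZ.IntegralRep (0 + 1 + 2)) (M : Fin m' → (Fin (0 + 1) → ℚ) × ℚ) (L : Fin m → (Fin 0 → ℚ) × ℚ) (e : Fin m → ℕ) (p : MvPolynomial (Fin 0) ℚ) (ℓ₁ ℓ₂ : (Fin 0 → ℚ) × ℚ) (a : Fin 2 → Option ((Fin (0 + 1) → ℚ) × ℚ)) (i j : Fin 2) (hij : i ≠ j) (A Bd ci cj : (Fin (0 + 1) → ℚ) × ℚ) (hi : a i = some ci) (hj : a j = some cj) (hB : Bd.1 (Fin.last 0) = cj.1 (Fin.last 0)) (hΔ : ci.1 (Fin.last 0) ≠ cj.1 (Fin.last 0)) (h1 : n₁ = 0) (hn : n₂ = 1) (hbd : Bornology.IsBounded s.domain) (hdom : s.domain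 = SeparatePos.gDom 0 2 m' M (RebaseNest.nlo i A) (RebaseNest.nhi j Bd)) (hint : EqOn s.integrand (RebasePos.glit 0 2 p L e ℓ₁ ℓ₂ n₁ n₂ a) s.domain) (hne : ∀ z ∈ s.domain, RebaseZero.tv z i ≠ RebaseZero.ev ci (RebaseZero.yv z)) (hy : ∀ z ∈ s.domain, RebaseZero.yv z ≠ ℓ₂.2) (C : ℝ) (hC : ∀ z ∈ s.domain, |RebaseZero.tv z i - RebaseZero.ev ci (RebaseZero.yv z)| ≤ C * |RebaseZero.tv z i - RebaseZero.ev (RebaseDiff.rot ci (cj.1 (Fin.last 0)) ℓ₂.2) (RebaseZero.yv z)|) : ∃ c ∈ AddSubgroup.closure (SeparatePos.GGset 0 2 2), KZ.of s - c ∈ KZ.relations :=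
  RebaseDiff.good_typeA s hij M A Bd L e p ℓ₁ ℓ₂ n₁ n₂ a ci cj hi hj hB hΔ h1 hn hbd hdom hint hne hy C hC

end Summit.KontsevichZagierPeriods.ArrangementNormalForm.JanusBands
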